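import Summits.ABC.StewartYu.KappaDoorPrelim
import HarnessLib

/-!
# Cell abc-stewartyu, the κ-DOOR, IIIa: the two-slot inequality for an abc triple, `c` even

`Summits/ABC/StewartYu/KappaDoorEven.lean` — cell `abc-stewartyu` (HOME
`run/shared/lean/pub/abc-stewartyu/`, seat p3; HOME/plan/KAPPA-DOOR-RECIPE.md; theorems only).

For an abc triple `a + b = c` (`a ≤ b`, `c ≥ 3`) and a `p`-adic input of shape
`K·Lⁿ·n^{κ'n}·p^σ·…` at every ODD prime (`κ' ≥ 1`, `0 ≤ σ ≤ 2`), exactly one member is even, and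
the two odd members carry `p`-adic slots (`KappaDoorSlot.log_le_of_kappaSlot`); when the small member
`a` is one of them and `a² < b`, its slot is replaced by the ARCHIMEDEAN slot on `log c`
(the tree's `log_le_of_archRoute` with Waldschmidt 1980 PROVED, `waldschmidt1980_hW₂`).  Multiplying
the two slots and absorbing `n^n`, the two top primes and the small logarithms by Chebyshev
(`pow_card_mul_prod_top_mul_prod_log_le`, `card_pow_card_le_rad`) exactly as in (17)–(18) of the
printed line [cite: StewartYu1991, (17)–(18)] gives

  `(log c)² ≤ 512·max(1,K)²·(600 M₀)^{2r}·600²·G²·(W²)^{κ'−1}·(log G)^{2τ₁+9}·(log(6 log c))^{2τ+1}`,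

`r = ω(abc)`, `G = rad(abc)`, `W = 600^{r+1} G`, `M₀ = max(L, 2^{71})` (`log_sq_le_of_finBound`).
The `ε`-endgame is in `KappaDoor.lean`. Everything is [folklore] book-keeping.
-/

noncomputable section

open Finset Real
open Literature.NumberTheory.DiophantineGeometry
open Literature.NumberTheory.DiophantineGeometry.Pasten
open Literature.NumberTheory.Transcendental.Waldschmidt1980 (w80Cw w80Cw_nonneg w80Cw_le waldschmidt1980_hW₂)
open Literature.Barriers.ABC

namespace Summit.ABC.StewartYu

namespace KappaDoor

set_option maxHeartbeats 1600000 in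
/-- **The two-slot inequality when `c` is even** (slots at the odd members `a`, `b`; the archimedean slot replaces `a` when `a² < b`): see `KappaDoor.log_sq_le_of_finBound`. [folklore] -/
theorem log_sq_le_of_finBound_even {K L κ' σ : ℝ} {τ τ₁ : ℕ} (hK : 0 ≤ K) (hL : 1 ≤ L) (hκ' : 1 ≤ κ')
    (hσ0 : 0 ≤ σ) (hσ : σ ≤ 2) (hP : ∀ p : ℕ, p.Prime → p ≠ 2 → FinBoundAt p K L κ' σ τ τ₁)
    {a b c : ℕ} (h : IsABCTriple a b c) (hab : a ≤ b) (hc3 : 3 ≤ c) (hc_even : Even c) :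
    Real.log c ^ 2 ≤ 512 * max 1 K ^ 2 * (600 * max L (2 ^ 71)) ^ (2 * (a * b * c).primeFactors.card) *
      600 ^ 2 * (rad a b c : ℝ) ^ 2 *
      (((600 : ℝ) ^ ((a * b * c).primeFactors.card + 1) * (rad a b c : ℝ)) ^ 2) ^ (κ' - 1) *
      Real.log (rad a b c : ℝ) ^ (2 * τ₁ + 9) * Real.log (6 * Real.log c) ^ (2 * τ + 1) := by
  classical
  obtain ⟨ha, hb, habc, hcop⟩ := id h
  have hc0 : c ≠ 0 := by omega
  have ha0 : a ≠ 0 := ha.ne'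
  have hb0 : b ≠ 0 := hb.ne'
  have hb2 : 2 ≤ b := by
    by_contra hlt
    have hb1 : b = 1 := by omega
    have ha1 : a = 1 := by omega
    omega
  have hneq : a ≠ b := by
    intro heq
    rw [heq] at hcop
    have : b = 1 := by simpa using hcop
    omega
  have hac : a.Coprime c := coprime_left_of_isABCTriple h
  have hbc : b.Coprime c := coprime_right_of_isABCTriple h
  have hac_le : a ≤ c := by omega
  have hbc_le : b ≤ c := by omega
  -- the sets of primes
  set Sa := a.primeFactors with hSa
  set Sb := b.primeFactors with hSb
  set Sc := c.primeFactors with hSc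
  set S := (a * b * c).primeFactors with hS
  set r : ℕ := S.card with hr
  have hSab : (a * b).primeFactors = Sa ∪ Sb := Nat.primeFactors_mul ha0 hb0
  have hSca : (c * a).primeFactors = Sc ∪ Sa := Nat.primeFactors_mul hc0 ha0
  have hScb : (c * b).primeFactors = Sc ∪ Sb := Nat.primeFactors_mul hc0 hb0
  have hSabc : S = Sa ∪ Sb ∪ Sc := by
    rw [hS, Nat.primeFactors_mul (mul_ne_zero ha0 hb0) hc0, hSab]
  have hdab : Disjoint Sa Sb := hcop.disjoint_primeFactors
  have hdac : Disjoint Sa Sc := hac.disjoint_primeFactors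
  have hdbc : Disjoint Sb Sc := hbc.disjoint_primeFactors
  have hSaS : Sa ⊆ S := by rw [hSabc]; exact Finset.subset_union_left.trans Finset.subset_union_left
  have hSbS : Sb ⊆ S := by rw [hSabc]; exact Finset.subset_union_right.trans Finset.subset_union_left
  have hScS : Sc ⊆ S := by rw [hSabc]; exact Finset.subset_union_right
  have hSprime : ∀ q ∈ S, q.Prime := fun q hq => Nat.prime_of_mem_primeFactors hq
  have hSaprime : ∀ q ∈ Sa, q.Prime := fun q hq => Nat.prime_of_mem_primeFactors hq
  have hSbprime : ∀ q ∈ Sb, q.Prime := fun q hq => Nat.prime_of_mem_primeFactors hq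
  have hScprime : ∀ q ∈ Sc, q.Prime := fun q hq => Nat.prime_of_mem_primeFactors hq
  have hrsum : r = Sa.card + Sb.card + Sc.card := by
    rw [hr, hSabc, Finset.card_union_of_disjoint (Finset.disjoint_union_left.mpr ⟨hdac, hdbc⟩),
      Finset.card_union_of_disjoint hdab]
  have hSbne : Sb.Nonempty := Nat.nonempty_primeFactors.mpr (by omega)
  have hScne : Sc.Nonempty := Nat.nonempty_primeFactors.mpr (by omega)
  have hr1 : 1 ≤ r := by rw [hr]; exact Finset.card_pos.mpr (hScne.mono hScS)
  -- the radical and its factors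
  set ρa : ℝ := ∏ q ∈ Sa, (q : ℝ) with hρa
  set ρb : ℝ := ∏ q ∈ Sb, (q : ℝ) with hρb
  set ρc : ℝ := ∏ q ∈ Sc, (q : ℝ) with hρc
  have hρa1 : 1 ≤ ρa := by
    rw [hρa, ← Nat.cast_prod]; exact_mod_cast Finset.prod_pos fun q hq => (hSaprime q hq).pos
  have hρb1 : 1 ≤ ρb := by
    rw [hρb, ← Nat.cast_prod]; exact_mod_cast Finset.prod_pos fun q hq => (hSbprime q hq).pos
  have hρc1 : 1 ≤ ρc := by
    rw [hρc, ← Nat.cast_prod]; exact_mod_cast Finset.prod_pos fun q hq => (hScprime q hq).pos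
  set G : ℝ := (rad a b c : ℝ) with hGdef
  have hradS : rad a b c = ∏ q ∈ S, q := by
    rw [rad_def, Nat.radical_eq_prod_primeFactors]
  have hGprod : G = ∏ q ∈ S, (q : ℝ) := by rw [hGdef, hradS]; push_cast; rfl
  have hGabc : G = ρa * ρb * ρc := by
    rw [hGprod, hSabc, Finset.prod_union (Finset.disjoint_union_left.mpr ⟨hdac, hdbc⟩),
      Finset.prod_union hdab]
  have hG4 : (4 : ℝ) ≤ G := four_le_rad h hab hc3
  have hG1 : (1 : ℝ) ≤ G := by linarith
  have hG0 : (0 : ℝ) < G := by linarith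
  have hρa0 : 0 ≤ ρa := by linarith
  have hρb0 : 0 ≤ ρb := by linarith
  have hρc0 : 0 ≤ ρc := by linarith
  -- products over the generator sets
  have hPab : ∏ q ∈ (a * b).primeFactors, (q : ℝ) = ρa * ρb := by rw [hSab, Finset.prod_union hdab]
  have hPca : ∏ q ∈ (c * a).primeFactors, (q : ℝ) = ρc * ρa := by rw [hSca, Finset.prod_union hdac.symm]
  have hPcb : ∏ q ∈ (c * b).primeFactors, (q : ℝ) = ρc * ρb := by rw [hScb, Finset.prod_union hdbc.symm]
  have hPa_ : ∏ p ∈ a.primeFactors, (p : ℝ) = ρa := rfl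
  have hPb_ : ∏ p ∈ b.primeFactors, (p : ℝ) = ρb := rfl
  have hPc_ : ∏ p ∈ c.primeFactors, (p : ℝ) = ρc := rfl
  -- logarithms
  set LG : ℝ := Real.log G with hLG
  have hLG1 : 1 ≤ LG := by
    rw [hLG, ← Real.log_exp 1]
    apply Real.log_le_log (Real.exp_pos 1)
    have := Real.exp_one_lt_d9; linarith
  have hLG0 : 0 ≤ LG := by linarith
  have hqG : ∀ q ∈ S, (q : ℝ) ≤ G := by
    intro q hq
    have h1 : q ∣ ∏ x ∈ S, x := Finset.dvd_prod_of_mem _ hq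
    have h2 : q ≤ rad a b c := by
      rw [hradS]; exact Nat.le_of_dvd (Finset.prod_pos fun x hx => (hSprime x hx).pos) h1
    rw [hGdef]; exact_mod_cast h2
  have hlog4G : ∀ q ∈ S, Real.log ((max 4 q : ℕ) : ℝ) ≤ LG := by
    intro q hq
    apply Real.log_le_log (by exact_mod_cast lt_of_lt_of_le (by norm_num) (le_max_left 4 q))
    have : ((max 4 q : ℕ) : ℝ) = max (4 : ℝ) (q : ℝ) := by push_cast; rfl
    rw [this]; exact max_le hG4 (hqG q hq)
  set Lc : ℝ := Real.log (6 * Real.log c) with hLc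
  have hc3r : (3 : ℝ) ≤ c := by exact_mod_cast hc3
  have hlogc1 : 1 ≤ Real.log c := by
    rw [← Real.log_exp 1]
    apply Real.log_le_log (Real.exp_pos 1)
    have := Real.exp_one_lt_d9; linarith
  have hlogc0 : 0 ≤ Real.log c := by linarith
  have hB3 : (3 : ℝ) ≤ 6 * Real.log c := by linarith
  have hLc1 : 1 ≤ Lc := by
    rw [hLc, ← Real.log_exp 1]
    apply Real.log_le_log (Real.exp_pos 1)
    have := Real.exp_one_lt_d9; linarith
  have hLc0 : 0 ≤ Lc := by linarith
  -- the slot bundle `Y₀ = Lc^τ LG^{τ₁} LG` and the final bundle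
  set Y₀ : ℝ := Lc ^ τ * LG ^ τ₁ * LG with hY₀
  have hY₀0 : 0 ≤ Y₀ := by positivity
  have hY₀1 : 1 ≤ Y₀ := one_le_mul_of_one_le_of_one_le (one_le_mul_of_one_le_of_one_le
    (one_le_pow₀ hLc1) (one_le_pow₀ hLG1)) hLG1
  set Yt : ℝ := LG ^ (2 * τ₁ + 3) * Lc ^ (2 * τ + 1) with hYt
  have hYsq : Y₀ ^ 2 ≤ Yt := by
    have e : Y₀ ^ 2 = LG ^ (2 * τ₁ + 2) * Lc ^ (2 * τ) := by rw [hY₀]; ring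
    rw [e, hYt]
    exact mul_le_mul (pow_le_pow_right₀ hLG1 (by omega)) (pow_le_pow_right₀ hLc1 (by omega))
      (by positivity) (by positivity)
  have hYarch : (4 * Y₀) * (Lc * LG ^ 2) ≤ 4 * Yt := by
    have e : (4 * Y₀) * (Lc * LG ^ 2) = 4 * (LG ^ (τ₁ + 3) * Lc ^ (τ + 1)) := by rw [hY₀]; ring
    rw [e, hYt]
    refine mul_le_mul_of_nonneg_left ?_ (by norm_num)
    exact mul_le_mul (pow_le_pow_right₀ hLG1 (by omega)) (pow_le_pow_right₀ hLc1 (by omega))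
      (by positivity) (by positivity)
  -- constants
  set M₀ : ℝ := max L (2 ^ 71) with hM₀
  have hLM : L ≤ M₀ := le_max_left _ _
  have hCM : (2 : ℝ) ^ 71 ≤ M₀ := le_max_right _ _
  have hL0 : 0 ≤ L := by linarith
  set W : ℝ := 600 ^ (r + 1) * G with hW
  have hW1 : 1 ≤ W := one_le_mul_of_one_le_of_one_le (one_le_pow₀ (by norm_num)) hG1
  have hrr : ((r : ℝ)) ^ r ≤ W := by rw [hW, hGdef, hr]; exact card_pow_card_le_rad a b c
  -- cardinalities
  have hnab : (a * b).primeFactors.card = Sa.card + Sb.card := by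
    rw [hSab, Finset.card_union_of_disjoint hdab]
  have hnca : (c * a).primeFactors.card = Sc.card + Sa.card := by
    rw [hSca, Finset.card_union_of_disjoint hdac.symm]
  have hncb : (c * b).primeFactors.card = Sc.card + Sb.card := by
    rw [hScb, Finset.card_union_of_disjoint hdbc.symm]
  -- top primes
  have hPa1 : (1 : ℝ) ≤ largestPrimeFactor a := by exact_mod_cast one_le_largestPrimeFactor a
  have hPb1 : (1 : ℝ) ≤ largestPrimeFactor b := by exact_mod_cast one_le_largestPrimeFactor b
  have hPc1 : (1 : ℝ) ≤ largestPrimeFactor c := by exact_mod_cast one_le_largestPrimeFactor c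
  have hPle : ∀ {w : ℕ} (Sw : Finset ℕ), Sw = w.primeFactors → (largestPrimeFactor w : ℝ) ≤ ∏ q ∈ Sw, (q : ℝ) := by
    intro w Sw hSw
    rw [hSw, ← prod_filter_eq_largestPrimeFactor w]
    rw [← Nat.cast_prod, ← Nat.cast_prod]
    exact_mod_cast Finset.prod_le_prod_of_subset_of_one_le' (Finset.filter_subset _ _)
      fun q hq _ => (Nat.prime_of_mem_primeFactors hq).one_lt.le
  have hPaρ : (largestPrimeFactor a : ℝ) ≤ ρa := hPle Sa rfl
  have hPbρ : (largestPrimeFactor b : ℝ) ≤ ρb := hPle Sb rfl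
  have hPcρ : (largestPrimeFactor c : ℝ) ≤ ρc := hPle Sc rfl
  have hSabS : (a * b).primeFactors ⊆ S := by rw [hSab]; exact Finset.union_subset hSaS hSbS
  have hScaS : (c * a).primeFactors ⊆ S := by rw [hSca]; exact Finset.union_subset hScS hSaS
  have hScbS : (c * b).primeFactors ⊆ S := by rw [hScb]; exact Finset.union_subset hScS hSbS
  have hmK : (1 : ℝ) ≤ max 1 K := le_max_left _ _
  have hKm : K ≤ max 1 K := le_max_right _ _
  -- ### the common final shape
  have hWκ : 0 ≤ (W ^ 2) ^ (κ' - 1) := Real.rpow_nonneg (by positivity) _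
  have hYt0 : 0 ≤ Yt := by positivity
  have hfin : ∀ {A M Yx : ℝ}, A ≤ 128 * max 1 K ^ 2 → 1 ≤ M → M ≤ M₀ → 0 ≤ Yx → Yx ≤ 4 * Yt →
      Real.log c ^ 2 ≤ A * (600 * M) ^ (2 * r) * 600 ^ 2 * G ^ 2 * (W ^ 2) ^ (κ' - 1) * LG ^ 6 * Yx →
      Real.log c ^ 2 ≤ 512 * max 1 K ^ 2 * (600 * M₀) ^ (2 * r) * 600 ^ 2 * G ^ 2 *
        (W ^ 2) ^ (κ' - 1) * LG ^ (2 * τ₁ + 9) * Lc ^ (2 * τ + 1) :=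
    fun hA hM1 hM hYx0 hYx hmain => final_shape hA hM1 hM hYx0 (by rw [hYt] at hYx; exact hYx) hWκ hmain
  -- sizes used repeatedly
  have hloga0 : 0 ≤ Real.log a := Real.log_nonneg (by exact_mod_cast ha)
  have hlogb0 : 0 ≤ Real.log b := Real.log_nonneg (by exact_mod_cast hb)
  have hmsq : max 1 K ≤ max 1 K ^ 2 := le_self_pow₀ hmK two_ne_zero
  have hK16 : 16 * K ≤ 128 * max 1 K ^ 2 := by
    calc 16 * K ≤ 16 * max 1 K := mul_le_mul_of_nonneg_left hKm (by norm_num)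
      _ ≤ 16 * max 1 K ^ 2 := mul_le_mul_of_nonneg_left hmsq (by norm_num)
      _ ≤ 128 * max 1 K ^ 2 := by
          have : 0 ≤ max 1 K ^ 2 := by positivity
          linarith only [this]
  have hKsq : K ^ 2 ≤ max 1 K ^ 2 := pow_le_pow_left₀ hK hKm 2
  have hm2 : 0 ≤ max 1 K ^ 2 := by positivity
  have hK32 : 32 * K ^ 2 ≤ 128 * max 1 K ^ 2 := by linarith only [hKsq, hm2]
  have hK8 : 8 * K ^ 2 ≤ 128 * max 1 K ^ 2 := by linarith only [hKsq, hm2]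
  have hK4 : 4 * K ^ 2 ≤ 128 * max 1 K ^ 2 := by linarith only [hKsq, hm2]
  have hM₀1 : 1 ≤ M₀ := hL.trans hLM
  have hΩ4_0 : ∀ U : Finset ℕ, 0 ≤ ∏ q ∈ U, Real.log ((max 4 q : ℕ) : ℝ) := fun U =>
    zero_le_one.trans (one_le_prod_log_max_four U)
  have hcardab : (a * b).primeFactors.card ≤ r := by rw [hnab, hrsum]; omega
  have hcardca : (c * a).primeFactors.card ≤ r := by rw [hnca, hrsum]; omega
  have hcardcb : (c * b).primeFactors.card ≤ r := by rw [hncb, hrsum]; omega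
  have hG2 : G ^ 2 = (ρa * ρb * ρc) ^ 2 := by rw [hGabc]
  have hfold : Real.log (6 * Real.log c) ^ τ * Real.log (rad a b c : ℝ) ^ τ₁ * Real.log (rad a b c : ℝ) = Y₀ := by
    rw [hY₀, hLc, hLG]
  have hfold2 : Real.log (6 * Real.log c) * Real.log (rad a b c : ℝ) ^ 2 = Lc * LG ^ 2 := by
    rw [hLc, hLG]
  have slotC : Odd c → Real.log c ≤ (1 * K) * L ^ (a * b).primeFactors.card *
      ((((a * b).primeFactors.card : ℝ)) ^ (a * b).primeFactors.card) ^ κ' *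
      (largestPrimeFactor c : ℝ) ^ σ * (∏ q ∈ (a * b).primeFactors, Real.log ((max 4 q : ℕ) : ℝ)) * Y₀ :=
    fun hodd => by have := slot_c hK hL hσ0 hP h hab hc3 hodd; rwa [hfold] at this
  have hlogcb : Real.log c ≤ 4 * Real.log b := by
    have h2b : (c : ℝ) ≤ 2 * b := by exact_mod_cast (show c ≤ 2 * b by omega)
    have hb2r : (2 : ℝ) ≤ b := by exact_mod_cast hb2
    have hlog2b : Real.log 2 ≤ Real.log b := Real.log_le_log two_pos hb2r
    calc Real.log c ≤ Real.log (2 * b) := Real.log_le_log (by positivity) h2b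
      _ = Real.log 2 + Real.log b := Real.log_mul two_ne_zero (by positivity)
      _ ≤ 4 * Real.log b := by linarith [Real.log_nonneg (by linarith : (1:ℝ) ≤ b)]
  have slotB : Odd b → Real.log b ≤ (1 * K) * L ^ (c * a).primeFactors.card *
      ((((c * a).primeFactors.card : ℝ)) ^ (c * a).primeFactors.card) ^ κ' *
      (largestPrimeFactor b : ℝ) ^ σ * (∏ q ∈ (c * a).primeFactors, Real.log ((max 4 q : ℕ) : ℝ)) * Y₀ :=
    fun hodd => by have := slot_b hK hL hσ0 hP h hab hc3 hodd; rwa [hfold] at this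
  have slotA : Odd a → Real.log a ≤ (1 * K) * L ^ (c * b).primeFactors.card *
      ((((c * b).primeFactors.card : ℝ)) ^ (c * b).primeFactors.card) ^ κ' *
      (largestPrimeFactor a : ℝ) ^ σ * (∏ q ∈ (c * b).primeFactors, Real.log ((max 4 q : ℕ) : ℝ)) * Y₀ :=
    fun hodd => by have := slot_a hK hL hσ0 hP h hab hc3 hodd; rwa [hfold] at this
  have slotArch : a ^ 2 < b → Real.log c ≤ 16 * (((2 : ℝ) ^ 71) ^ (c * b).primeFactors.card *
      (((c * b).primeFactors.card : ℝ)) ^ (c * b).primeFactors.card *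
      (∏ q ∈ (c * b).primeFactors, Real.log ((max 4 q : ℕ) : ℝ)) * (Lc * LG ^ 2)) :=
    fun hcase => by have := slot_arch h hab hc3 hcase; rwa [hfold2] at this
  -- ### parity: exactly one member is even
  have hodd_of : ∀ {x y : ℕ}, x.Coprime y → Even x → Odd y := by
    intro x y hxy hx
    by_contra hy
    rw [Nat.not_odd_iff_even] at hy
    have h2 : 2 ∣ Nat.gcd x y := Nat.dvd_gcd (even_iff_two_dvd.mp hx) (even_iff_two_dvd.mp hy)
    rw [hxy.gcd_eq_one] at h2
    omega
  -- `c` even ⇒ `a`, `b` odd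
  have ha_odd : Odd a := hodd_of hac.symm hc_even
  have hb_odd : Odd b := hodd_of hbc.symm hc_even
  have hB := slotB hb_odd
  rw [one_mul] at hB
  by_cases hcase : a ^ 2 < b
  · -- slot at `b` (for `log c ≤ 4 log b`) × archimedean slot
    have hA := slotArch hcase
    have h₁ : Real.log c ≤ K * L ^ (c * a).primeFactors.card *
        ((((c * a).primeFactors.card : ℝ)) ^ (c * a).primeFactors.card) ^ κ' *
        (largestPrimeFactor b : ℝ) ^ σ * (∏ q ∈ (c * a).primeFactors, Real.log ((max 4 q : ℕ) : ℝ)) *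
        (4 * Y₀) := by
      refine hlogcb.trans ?_
      calc 4 * Real.log b ≤ 4 * (K * L ^ (c * a).primeFactors.card *
          ((((c * a).primeFactors.card : ℝ)) ^ (c * a).primeFactors.card) ^ κ' *
          (largestPrimeFactor b : ℝ) ^ σ * (∏ q ∈ (c * a).primeFactors, Real.log ((max 4 q : ℕ) : ℝ)) * Y₀) :=
            mul_le_mul_of_nonneg_left hB (by norm_num)
        _ = _ := by ring
    have habs := absorb_none hSprime hlog4G hLG1 hScaS
    have habs' := absorb_top (T₀ := (c * b).primeFactors) hSprime hlog4G hLG1 b (by rw [hScb]; exact Finset.subset_union_right) hScbS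
    rw [hPca] at habs
    rw [hPcb] at habs'
    have hGρ : ρc * ρa * (ρc * ρb) * ρb ≤ G ^ 2 := by
      rw [hG2]
      have hsq : ρa ≤ ρa ^ 2 := le_self_pow₀ hρa1 two_ne_zero
      calc ρc * ρa * (ρc * ρb) * ρb = ρa * (ρb ^ 2 * ρc ^ 2) := by ring
        _ ≤ ρa ^ 2 * (ρb ^ 2 * ρc ^ 2) := mul_le_mul_of_nonneg_right hsq (by positivity)
        _ = (ρa * ρb * ρc) ^ 2 := by ring
    have key := slot_arch_bound (K := K) (L := L) (C := (2 : ℝ) ^ 71) (M₀ := M₀) (κ' := κ') (σ := σ)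
      (u := Real.log c) (N := (((c * a).primeFactors.card : ℝ)) ^ (c * a).primeFactors.card)
      (N' := (((c * b).primeFactors.card : ℝ)) ^ (c * b).primeFactors.card)
      (P := (largestPrimeFactor b : ℝ)) (Ω := ∏ q ∈ (c * a).primeFactors, Real.log ((max 4 q : ℕ) : ℝ))
      (Ω' := ∏ q ∈ (c * b).primeFactors, Real.log ((max 4 q : ℕ) : ℝ)) (Y := 4 * Y₀) (Y' := Lc * LG ^ 2)
      (R := ρc * ρa) (R' := ρc * ρb) (ρ := ρb) (Λ := LG) (G := G) (W := W)
      (n := (c * a).primeFactors.card) (n' := (c * b).primeFactors.card) (r := r)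
      hK hL (by norm_num) hLM hCM hκ' hσ hlogc0
      (one_le_pow_self _) (pow_nonneg (Nat.cast_nonneg _) _) hPb1 (hΩ4_0 _) (hΩ4_0 _)
      (by positivity) (by positivity) (by positivity) (by positivity) hLG0 hW1
      h₁ hA habs habs' hPbρ hGρ (pow_self_le_of_le hrr hr1 hcardca) (by rw [hnca, hncb, hrsum]; omega)
    refine hfin hK16 hM₀1 le_rfl (by positivity) ?_ key
    calc 4 * Y₀ * (Lc * LG ^ 2) = (4 * Y₀) * (Lc * LG ^ 2) := by ring
      _ ≤ 4 * Yt := hYarch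
  · -- two slots: `a` (`log c ≤ 8 log a`) and `b` (`log c ≤ 4 log b`)
    push Not at hcase
    have hA := slotA ha_odd
    rw [one_mul] at hA
    have hloga : Real.log c ≤ 8 * Real.log a := by
      have h1 : (b : ℝ) ≤ (a : ℝ) ^ 2 := by exact_mod_cast hcase
      have h2 : Real.log b ≤ 2 * Real.log a := by
        have e : Real.log ((a : ℝ) ^ 2) = 2 * Real.log a := by rw [Real.log_pow]; norm_num
        rw [← e]
        exact Real.log_le_log (by exact_mod_cast hb) h1
      calc Real.log c ≤ 4 * Real.log b := hlogcb
        _ ≤ 4 * (2 * Real.log a) := mul_le_mul_of_nonneg_left h2 (by norm_num)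
        _ = 8 * Real.log a := by ring
    have habs₁ := absorb_top (T₀ := (c * b).primeFactors) hSprime hlog4G hLG1 b (by rw [hScb]; exact Finset.subset_union_right) hScbS
    have habs₂ := absorb_top (T₀ := (c * a).primeFactors) hSprime hlog4G hLG1 a (by rw [hSca]; exact Finset.subset_union_right) hScaS
    rw [hPcb] at habs₁
    rw [hPca] at habs₂
    have hGρ : ρc * ρb * (ρc * ρa) * (ρa * ρb) ≤ G ^ 2 := by rw [hG2]; apply le_of_eq; ring
    have key := two_slot_bound (K := K) (L := L) (κ' := κ') (σ := σ) (u₁ := Real.log a) (u₂ := Real.log b)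
      (N₁ := (((c * b).primeFactors.card : ℝ)) ^ (c * b).primeFactors.card)
      (N₂ := (((c * a).primeFactors.card : ℝ)) ^ (c * a).primeFactors.card)
      (P₁ := (largestPrimeFactor a : ℝ)) (P₂ := (largestPrimeFactor b : ℝ))
      (Ω₁ := ∏ q ∈ (c * b).primeFactors, Real.log ((max 4 q : ℕ) : ℝ))
      (Ω₂ := ∏ q ∈ (c * a).primeFactors, Real.log ((max 4 q : ℕ) : ℝ)) (Y := Y₀)
      (R₁ := ρc * ρb) (R₂ := ρc * ρa) (ρ₁ := ρa) (ρ₂ := ρb) (Λ := LG) (G := G) (W := W)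
      (n₁ := (c * b).primeFactors.card) (n₂ := (c * a).primeFactors.card) (r := r)
      hK hL hκ' hσ hloga0 hlogb0 (one_le_pow_self _) (one_le_pow_self _) hPa1 hPb1
      (hΩ4_0 _) (hΩ4_0 _) hY₀0 (by positivity) (by positivity) hLG0
      hA hB habs₁ habs₂ hPaρ hPbρ hGρ (pow_self_mul_le_sq hrr hr1 hcardcb hcardca (by rw [hnca, hncb, hrsum]; omega))
      (by rw [hnca, hncb, hrsum]; omega)
    have hsq : Real.log c ^ 2 ≤ 32 * (Real.log a * Real.log b) := by
      calc Real.log c ^ 2 = Real.log c * Real.log c := sq _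
        _ ≤ (8 * Real.log a) * (4 * Real.log b) := mul_le_mul hloga hlogcb hlogc0 (mul_nonneg (by norm_num) hloga0)
        _ = 32 * (Real.log a * Real.log b) := by ring
    refine hfin (A := 32 * K ^ 2) hK32 hL hLM (by positivity)
      (hYsq.trans (le_mul_of_one_le_left hYt0 (by norm_num))) ?_
    calc Real.log c ^ 2 ≤ 32 * (Real.log a * Real.log b) := hsq
      _ ≤ 32 * (K ^ 2 * (600 * L) ^ (2 * r) * 600 ^ 2 * G ^ 2 * (W ^ 2) ^ (κ' - 1) * LG ^ 6 * Y₀ ^ 2) :=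
          mul_le_mul_of_nonneg_left key (by norm_num)
      _ = 32 * K ^ 2 * (600 * L) ^ (2 * r) * 600 ^ 2 * G ^ 2 * (W ^ 2) ^ (κ' - 1) * LG ^ 6 * Y₀ ^ 2 := by
          ring

end KappaDoor

end Summit.ABC.StewartYu

end
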